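import Summits.QuantumFields.YangMills.Theorems.BalabanUVNodesN22AtU3OfKernels

/-!
# NODE N22 AT THE KERNEL-KEYED NODE-U3 OBJECTS — THE EXISTENCE INPUT OF THE (1.21) PASSAGE IN FINITE-VOLUME CURRENCY:
# def-B's `PolLimitExists` from Cauchy ∕ geometric VOLUME-INCREMENTS ∕ eventual constancy of the windowed kernels, and `N22At` at the kernel objects of
# record from THREE finite-volume displayed inputs (signs, geometric volume-increments, windowed joint history-Lipschitz bounds)

Cell `pub-ymgap`, Track A (HUMAN RULING D-0062), WIDTH SEAT `dag-n22-w3` g2 on node n22 = NE9; `--kind proof --supports stmt-QuantumFields-20544 --as helper`,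
COUNT-NEUTRAL.  Sequel of `Thm/BalabanUVNodesN22AtU3OfKernels.lean` (p593053): there the N22 slot at the node-U3 object OF RECORD (plan g81 Q1 RULING (β),
`Node00.U3OfKernels.objectsOfRecord₁₃`) follows from (i) def-B's NAMED existence property `Node00.PolLimitExists` of the (1.21) limits and (ii) the windowed joint
history-Lipschitz bounds.  Input (i) is [I] p. 264 «This limit exists by the localized representation (1.7)»: the windowed kernels on the tori `T^{(k+1)}_K ↗ Z^d` of ONE
family STABILISE — the difference between consecutive volumes comes from localization domains that feel the volume, exponentially few.  This file types the
estimate-free half of that sentence: the real line is complete, so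

* §1 `polLimitExists_of_cauchySeq` (Cauchy windowed kernels ⇒ the limit exists), ★ `polLimitExists_of_geometric_increments` (VOLUME-INCREMENTS `|Π^{(K+1)} − Π^{(K)}| ≤
  C r^K`, `r < 1`, one constant per `(μ, ν, z)` ⇒ Cauchy, `cauchySeq_of_le_geometric`), `polLimitExists_of_eventually_geometric_increments` (the same from a threshold `K₀` on —
  print's representation is valid once the torus carries the step; index shift `Filter.tendsto_add_atTop_iff_nat`), `polLimitExists_of_eventually_const` (strictly
  stabilising kernels);
* §2 the HISTORY-INDEXED editions feeding `ne9_EA_of_windowed`'s `hlim` (`polLimitExists_histories_of_geometric_increments`) and ★ `ne9_EA_of_increments_of_windowed`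
  (NE9 of W1-19's kernel functional from geometric volume-increments + windowed bounds — BOTH inputs finite-volume statements), `n22At_u3OfRecord₁₃_objects_of_increments_of_windowed`;
* §3 at the record: ★★ `n22At_u3OfRecord₁₃_objectsOfRecord₁₃_of_increments_of_windowed` and the PIN form ★★ `n22At_rateCarriers_of_kernels_pin_of_increments` — the N22
  conjunct of K3⁷ v2's `RatesHolderAt` at the kernel-pinned reading from `ℓ.Signs` + geometric volume-increments of the windowed kernels of record + the windowed joint
  history-Lipschitz bounds of record (LOCATED: all three displayed; nothing of the record is claimed to meet them).

HONEST FRAMING (binding).  `Filter`∕metric bookkeeping; THEOREMS ONLY (0 def, 0 sorry, standard axioms).  The geometric volume-increment bound (the quantitative content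
of [I] p. 264's existence sentence, NOT displayed in print as such) and the windowed history-Lipschitz bounds (NE9 at finite volume, NOT PRINTED for d = 4) STAY DISPLAYED
HYPOTHESES; nothing of Bałaban's is asserted; N22 NOT discharged; K3⁷ OPEN, not claimed; no count claim; one finite 𝕋⁴ programme at fixed ε — R4 closes the conditional rung
`BalabanLadder.UV` only; NOTHING about the continuum limit, ℝ⁴, OS axioms, a mass gap or Clay is proved or claimed.  No decl below carries a cite tag (Summit side).
-/

noncomputable section

open Filter Topology
open scoped BigOperators

namespace YMDAG.N22.AtKernels

open Literature.MathematicalPhysics.QuantumFieldTheory.Balaban1983to89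
open Literature.MathematicalPhysics.QuantumFieldTheory.Balaban1983to89.T4Continuum (T4Family ULoop)
open Literature.MathematicalPhysics.QuantumFieldTheory.Balaban1983to89.T4OutputRate (Window NE9)
open Literature.MathematicalPhysics.QuantumFieldTheory.Balaban1983to89.Node00 (TermFamily1 polWindow polLimit PolLimitExists mergedTermFamilyMatT TβOfRecord₁₃
  chiβOfRecord₁₃ Stage13Params Stage13HParams U3Letters₁₁)
open Literature.MathematicalPhysics.QuantumFieldTheory.Balaban1983to89.Node00.U3OfKernels (histPrefix kernelA EA objects objectsOfRecord₁₃)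
open Literature.MathematicalPhysics.QuantumFieldTheory.Balaban1983to89.B12Sec2to5 (l1)
open YMDAG.UVSplit (N22At u3OfRecord₁₃ RateReading₁₃CoPH rateCarriersOfRecord₁₃CoPH)

/-! ## §1 `PolLimitExists` from finite-volume stabilisation of the windowed kernels -/

section Existence

variable {𝔄 : Type*} [NormedRing 𝔄] [NormedAlgebra ℝ 𝔄]
variable {V : Type*} [NormedAddCommGroup V] [NormedSpace ℝ V] {ι : Type*} [Fintype ι]
variable (F : T4Family) (j : ℕ) (ℰK : (K : ℕ) → (Fin (F.P K).d → Site (F.P K) j → 𝔄) → ℝ) (ρ : V →L[ℝ] 𝔄) (bV : Module.Basis ι ℝ V)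

/-- **CAUCHY WINDOWED KERNELS ⇒ THE (1.21) LIMIT EXISTS** (the real line is complete). -/
theorem polLimitExists_of_cauchySeq (h : ∀ (μ ν : Fin 4) (z : Fin 4 → ℤ), CauchySeq fun K : ℕ => polWindow F K j (ℰK K) ρ bV μ ν z) :
    PolLimitExists F j ℰK ρ bV :=
  fun μ ν z => cauchySeq_tendsto_of_complete (h μ ν z)

/-- ★ **GEOMETRIC VOLUME-INCREMENTS ⇒ THE (1.21) LIMIT EXISTS**: if consecutive volumes change each windowed kernel entry by at most `C r^K` with `r < 1` (one constant per entry),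
the windowed kernels are Cauchy (`cauchySeq_of_le_geometric`) and `PolLimitExists` holds.  The estimate-free half of [I] p. 264 «This limit exists by the localized
representation (1.7)»; the increment bound itself stays displayed. -/
theorem polLimitExists_of_geometric_increments {r : ℝ} (hr : r < 1)
    (h : ∀ (μ ν : Fin 4) (z : Fin 4 → ℤ), ∃ C : ℝ, ∀ K : ℕ,
      |polWindow F (K + 1) j (ℰK (K + 1)) ρ bV μ ν z - polWindow F K j (ℰK K) ρ bV μ ν z| ≤ C * r ^ K) :
    PolLimitExists F j ℰK ρ bV := by
  refine polLimitExists_of_cauchySeq F j ℰK ρ bV fun μ ν z => ?_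
  obtain ⟨C, hC⟩ := h μ ν z
  refine cauchySeq_of_le_geometric r C hr fun K => ?_
  rw [Real.dist_eq, abs_sub_comm]
  exact hC K

/-- **… FROM A THRESHOLD ON**: the same when the geometric increment bound holds only for `K ≥ K₀` (print's representation needs the torus to carry the step): shift the
index by `K₀` (`Filter.tendsto_add_atTop_iff_nat`). -/
theorem polLimitExists_of_eventually_geometric_increments {r : ℝ} (hr : r < 1)
    (h : ∀ (μ ν : Fin 4) (z : Fin 4 → ℤ), ∃ (K₀ : ℕ) (C : ℝ), ∀ K : ℕ, K₀ ≤ K →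
      |polWindow F (K + 1) j (ℰK (K + 1)) ρ bV μ ν z - polWindow F K j (ℰK K) ρ bV μ ν z| ≤ C * r ^ K) :
    PolLimitExists F j ℰK ρ bV := by
  intro μ ν z
  obtain ⟨K₀, C, hC⟩ := h μ ν z
  -- the shifted sequence `K ↦ Π^{(K + K₀)}` has geometric increments `C r^{K₀} · r^K`
  have hcau : CauchySeq fun K : ℕ => polWindow F (K + K₀) j (ℰK (K + K₀)) ρ bV μ ν z := by
    refine cauchySeq_of_le_geometric r (C * r ^ K₀) hr fun K => ?_
    rw [Real.dist_eq, abs_sub_comm, Nat.add_right_comm K 1 K₀, mul_assoc, ← pow_add, add_comm K₀ K]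
    exact hC (K + K₀) (Nat.le_add_left K₀ K)
  obtain ⟨P, hP⟩ := cauchySeq_tendsto_of_complete hcau
  exact ⟨P, (tendsto_add_atTop_iff_nat (f := fun K : ℕ => polWindow F K j (ℰK K) ρ bV μ ν z) K₀).1 hP⟩

/-- **STRICTLY STABILISING KERNELS ⇒ THE LIMIT EXISTS** (each entry eventually constant in the volume index). -/
theorem polLimitExists_of_eventually_const
    (h : ∀ (μ ν : Fin 4) (z : Fin 4 → ℤ), ∃ (K₀ : ℕ) (P : ℝ), ∀ K : ℕ, K₀ ≤ K → polWindow F K j (ℰK K) ρ bV μ ν z = P) :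
    PolLimitExists F j ℰK ρ bV := by
  intro μ ν z
  obtain ⟨K₀, P, hK⟩ := h μ ν z
  exact ⟨P, tendsto_atTop_of_eventually_const fun K hK' => hK K hK'⟩

end Existence

/-! ## §2 History-indexed editions and NE9 ∕ N22 at the kernel objects from finite-volume inputs only -/

section Kernels

variable {𝔄 : Type*} [NormedRing 𝔄] [NormedAlgebra ℝ 𝔄]
variable {V : Type*} [NormedAddCommGroup V] [NormedSpace ℝ V] {ι : Type*} [Fintype ι]
variable (F : T4Family) (ℰ : TermFamily1 F 𝔄) (ρ : V →L[ℝ] 𝔄) (bV : Module.Basis ι ℝ V)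

/-- **THE `hlim` OF `ne9_EA_of_windowed` FROM GEOMETRIC VOLUME-INCREMENTS** at every history of the window and every level (one rate `r < 1`, one constant per
`(g, k, μ, ν, z)`, from a threshold `K₀` on). -/
theorem polLimitExists_histories_of_geometric_increments {W : Set (ℕ → ℝ)} {r : ℝ} (hr : r < 1)
    (h : ∀ g ∈ W, ∀ (k : ℕ) (μ ν : Fin 4) (z : Fin 4 → ℤ), ∃ (K₀ : ℕ) (C : ℝ), ∀ K : ℕ, K₀ ≤ K →
      |polWindow F (K + 1) (k + 1) (ℰ k (histPrefix g k) (K + 1)) ρ bV μ ν z - polWindow F K (k + 1) (ℰ k (histPrefix g k) K) ρ bV μ ν z| ≤ C * r ^ K) :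
    ∀ g ∈ W, ∀ k : ℕ, PolLimitExists F (k + 1) (fun K => ℰ k (histPrefix g k) K) ρ bV :=
  fun g hg k => polLimitExists_of_eventually_geometric_increments F (k + 1) (fun K => ℰ k (histPrefix g k) K) ρ bV hr (h g hg k)

/-- ★ **NE9 OF THE KERNEL FUNCTIONAL FROM FINITE-VOLUME INPUTS ONLY**: geometric volume-increments of the windowed kernels (⇒ (1.21) existence) + the windowed joint
history-Lipschitz bounds (eventually in `K`) ⇒ `NE9 (U3OfKernels.EA F ℰ ρ bV) W κ Λ`. -/
theorem ne9_EA_of_increments_of_windowed {W : Set (ℕ → ℝ)} {κ r : ℝ} {Λ : ℕ → ℕ → ℝ} (hr : r < 1)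
    (hinc : ∀ g ∈ W, ∀ (k : ℕ) (μ ν : Fin 4) (z : Fin 4 → ℤ), ∃ (K₀ : ℕ) (C : ℝ), ∀ K : ℕ, K₀ ≤ K →
      |polWindow F (K + 1) (k + 1) (ℰ k (histPrefix g k) (K + 1)) ρ bV μ ν z - polWindow F K (k + 1) (ℰ k (histPrefix g k) K) ρ bV μ ν z| ≤ C * r ^ K)
    (hK : ∀ g ∈ W, ∀ g' ∈ W, ∀ (k : ℕ) (μ ν : Fin 4) (z : Fin 4 → ℤ), ∀ᶠ K in atTop,
      |polWindow F K (k + 1) (ℰ k (histPrefix g k) K) ρ bV μ ν z - polWindow F K (k + 1) (ℰ k (histPrefix g' k) K) ρ bV μ ν z| ≤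
        Real.exp (-(κ * l1 z)) * ∑ i ∈ Finset.range (k + 1), Λ (k + 1) i * |g i - g' i|) :
    NE9 (EA F ℰ ρ bV) W κ Λ :=
  ne9_EA_of_windowed F ℰ ρ bV (polLimitExists_histories_of_geometric_increments F ℰ ρ bV hr hinc) hK

variable {N : ℕ} [NeZero N]

/-- `N22At` at the kernel objects from the signs and the two finite-volume inputs. -/
theorem n22At_u3OfRecord₁₃_objects_of_increments_of_windowed (θ : Stage13Params F N) (ℓ : U3Letters₁₁) (hs : ℓ.Signs) (k : ℕ) {r : ℝ} (hr : r < 1)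
    (hinc : ∀ g ∈ Window θ.γ, ∀ (j : ℕ) (μ ν : Fin 4) (z : Fin 4 → ℤ), ∃ (K₀ : ℕ) (C : ℝ), ∀ K : ℕ, K₀ ≤ K →
      |polWindow F (K + 1) (j + 1) (ℰ j (histPrefix g j) (K + 1)) ρ bV μ ν z - polWindow F K (j + 1) (ℰ j (histPrefix g j) K) ρ bV μ ν z| ≤ C * r ^ K)
    (hK : ∀ g ∈ Window θ.γ, ∀ g' ∈ Window θ.γ, ∀ (j : ℕ) (μ ν : Fin 4) (z : Fin 4 → ℤ), ∀ᶠ K in atTop,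
      |polWindow F K (j + 1) (ℰ j (histPrefix g j) K) ρ bV μ ν z - polWindow F K (j + 1) (ℰ j (histPrefix g' j) K) ρ bV μ ν z| ≤
        Real.exp (-(ℓ.κ * l1 z)) * ∑ i ∈ Finset.range (j + 1), ℓ.moduli (j + 1) i * |g i - g' i|) :
    N22At (u3OfRecord₁₃ θ (objects F ℰ ρ bV ℓ) k) :=
  n22At_u3OfRecord₁₃_objects_of_ne9 F ℰ ρ bV θ ℓ hs k (ne9_EA_of_increments_of_windowed F ℰ ρ bV hr hinc hK)

end Kernels

/-! ## §3 At the record, Stage 13: the objects of record and the PIN form -/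

section Record

open scoped Matrix.Norms.L2Operator

variable (F : T4Family) (N : ℕ) [NeZero N]

/-- ★★ **N22 AT THE KERNEL OBJECTS OF RECORD FROM THREE FINITE-VOLUME DISPLAYED INPUTS**: `ℓ.Signs`, geometric volume-increments of the windowed kernels of the merged term
family of record (⇒ the (1.21) limits of record exist), the windowed joint history-Lipschitz bounds of record with moduli `C₉ ω^{j+1−i}`.  LOCATED (hypothesis form). -/
theorem n22At_u3OfRecord₁₃_objectsOfRecord₁₃_of_increments_of_windowed (θ : Stage13Params F N) (ℓ : U3Letters₁₁) (hs : ℓ.Signs) (k : ℕ) {r : ℝ} (hr : r < 1)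
    (hinc : letI := θ.instVβ₁; letI := θ.instVβ₂; letI := θ.instιβ
      ∀ g ∈ Window θ.γ, ∀ (j : ℕ) (μ ν : Fin 4) (z : Fin 4 → ℤ), ∃ (K₀ : ℕ) (C : ℝ), ∀ K : ℕ, K₀ ≤ K →
        |polWindow F (K + 1) (j + 1) (mergedTermFamilyMatT F N (TβOfRecord₁₃ F N) (chiβOfRecord₁₃ F N θ) θ.εbg j (histPrefix g j) (K + 1)) θ.ρ8 θ.bV μ ν z -
            polWindow F K (j + 1) (mergedTermFamilyMatT F N (TβOfRecord₁₃ F N) (chiβOfRecord₁₃ F N θ) θ.εbg j (histPrefix g j) K) θ.ρ8 θ.bV μ ν z| ≤ C * r ^ K)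
    (hK : letI := θ.instVβ₁; letI := θ.instVβ₂; letI := θ.instιβ
      ∀ g ∈ Window θ.γ, ∀ g' ∈ Window θ.γ, ∀ (j : ℕ) (μ ν : Fin 4) (z : Fin 4 → ℤ), ∀ᶠ K in atTop,
        |polWindow F K (j + 1) (mergedTermFamilyMatT F N (TβOfRecord₁₃ F N) (chiβOfRecord₁₃ F N θ) θ.εbg j (histPrefix g j) K) θ.ρ8 θ.bV μ ν z -
            polWindow F K (j + 1) (mergedTermFamilyMatT F N (TβOfRecord₁₃ F N) (chiβOfRecord₁₃ F N θ) θ.εbg j (histPrefix g' j) K) θ.ρ8 θ.bV μ ν z| ≤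
          Real.exp (-(ℓ.κ * l1 z)) * ∑ i ∈ Finset.range (j + 1), ℓ.moduli (j + 1) i * |g i - g' i|) :
    N22At (u3OfRecord₁₃ θ (objectsOfRecord₁₃ F N θ ℓ) k) := by
  letI := θ.instVβ₁; letI := θ.instVβ₂; letI := θ.instιβ
  exact n22At_u3OfRecord₁₃_objects_of_increments_of_windowed F _ θ.ρ8 θ.bV θ ℓ hs k hr hinc hK

variable {N}

/-- ★★ **THE PIN FORM FROM THE THREE FINITE-VOLUME INPUTS**: under `hpin`, K3⁷ v2's N22 conjunct `N22At (rateCarriersOfRecord₁₃CoPH 𝔯 F θ hP g₀ os k).u3` at every run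
length.  LOCATED (hypothesis form); N22 NOT discharged. -/
theorem n22At_rateCarriers_of_kernels_pin_of_increments (𝔯 : RateReading₁₃CoPH N) {F : T4Family} (θ : Stage13HParams F N) (hP : θ.Provisos₁₃CoPH F N)
    (g₀ : ℕ → ℝ) (os : List (ULoop F)) (ℓ : U3Letters₁₁) (hs : ℓ.Signs)
    (hpin : (𝔯.lit F θ hP g₀ os).u3 = objectsOfRecord₁₃ F N θ.toStage13Params ℓ) {r : ℝ} (hr : r < 1)
    (hinc : letI := θ.instVβ₁; letI := θ.instVβ₂; letI := θ.instιβ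
      ∀ g ∈ Window θ.γ, ∀ (j : ℕ) (μ ν : Fin 4) (z : Fin 4 → ℤ), ∃ (K₀ : ℕ) (C : ℝ), ∀ K : ℕ, K₀ ≤ K →
        |polWindow F (K + 1) (j + 1)
              (mergedTermFamilyMatT F N (TβOfRecord₁₃ F N) (chiβOfRecord₁₃ F N θ.toStage13Params) θ.εbg j (histPrefix g j) (K + 1)) θ.ρ8 θ.bV μ ν z -
            polWindow F K (j + 1)
              (mergedTermFamilyMatT F N (TβOfRecord₁₃ F N) (chiβOfRecord₁₃ F N θ.toStage13Params) θ.εbg j (histPrefix g j) K) θ.ρ8 θ.bV μ ν z| ≤ C * r ^ K)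
    (hK : letI := θ.instVβ₁; letI := θ.instVβ₂; letI := θ.instιβ
      ∀ g ∈ Window θ.γ, ∀ g' ∈ Window θ.γ, ∀ (j : ℕ) (μ ν : Fin 4) (z : Fin 4 → ℤ), ∀ᶠ K in atTop,
        |polWindow F K (j + 1)
              (mergedTermFamilyMatT F N (TβOfRecord₁₃ F N) (chiβOfRecord₁₃ F N θ.toStage13Params) θ.εbg j (histPrefix g j) K) θ.ρ8 θ.bV μ ν z -
            polWindow F K (j + 1)
              (mergedTermFamilyMatT F N (TβOfRecord₁₃ F N) (chiβOfRecord₁₃ F N θ.toStage13Params) θ.εbg j (histPrefix g' j) K) θ.ρ8 θ.bV μ ν z| ≤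
          Real.exp (-(ℓ.κ * l1 z)) * ∑ i ∈ Finset.range (j + 1), ℓ.moduli (j + 1) i * |g i - g' i|)
    (k : ℕ) : N22At (rateCarriersOfRecord₁₃CoPH 𝔯 F θ hP g₀ os k).u3 := by
  show N22At (u3OfRecord₁₃ θ.toStage13Params (𝔯.lit F θ hP g₀ os).u3 k)
  rw [hpin]
  exact n22At_u3OfRecord₁₃_objectsOfRecord₁₃_of_increments_of_windowed F N θ.toStage13Params ℓ hs k hr hinc hK

end Record

end YMDAG.N22.AtKernels

end
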